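import Literature.NumberTheory.Weil1964.UnitaryArchLocalSkewCongr       -- ★ p844665 FILE 1 (this seat): `exists_conjEquivC`, `setLIntegral_cayleyWeightC_cayleySourceC_eq_of_conj`, transport lemmas
import HarnessLib

/-!
# All DEFINITE real diagonal one-place carriers of the same size have the same window-free top-form integral `∫_{source} w₀ dλ` ((U) road, U4-DISCHARGE (cpt) half,
# LEAD F0P3a-plan (g10) WORD T9-40 (d2), FILE 3; Rogawski 1990 §1.7, Macdonald 1980)

Topic `NumberTheory/Weil1964`; namespace `Literature.NumberTheory.Weil1964.UnitaryArchLocalTopForm`.  THEOREMS ONLY (no `def`, no instance, no notation, no axiom, no named fact,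
no `sorry`).  Cell `pub/hodgecm-mathlib`, crux H413 = `stmt-HodgeConjecture-24833` (supports only).  Count-neutral.  HONEST LABEL: HC_CM is proved only modulo the printed
citations until rung 0 closes.  U4 `ArchTopFormWallCompatible` (★ p844462) (cpt) asks ONE `V = vol^TF(U(σ_w diag(β₀,β₂))(ℂ))·vol^TF(U(σ_w β₁)(ℂ))` for all real diagonal carriers
with `re σβ₀ · re σβ₂ > 0` at all complex places; once «`vol^TF(U(Jw)) = ∫_{source(Jw)} w₀ dλ`» (piece (ii), A-p06 (g29)) is in, this file makes `V` carrier- and place-free: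

* §1 `skewC_real_smul` (`𝔲(r J) = 𝔲(J)` for real `r ≠ 0`, in particular `𝔲(−J) = 𝔲(J)`), `exists_conjEquivC_one_of_skewC_eq` (the identity of carriers as an `Ad 1`-equivalence
  — so ★ FILE 1's transport lemmas apply with `T = 1`), `setLIntegral_cayleyWeightC_cayleySourceC_eq_of_skewC_eq`.
* §2 `formCongr_diagonal_real_sqrt` ∕ `exists_formCongr_diagonal_of_forall_mul_pos`: same-sign real diagonal forms are congruent by a positive real diagonal `T = diag(√(d′ᵢ∕dᵢ))`.
* §3 **`setLIntegral_cayleyWeightC_cayleySourceC_eq_of_definite_diagonal`**: for real diagonal `d, d′ : Fin n → ℝ` with all `dᵢ` of one sign and all `d′ᵢ` of one sign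
  (the two signs may differ), `∫_{source(diag d)} w₀ dλ = ∫_{source(diag d′)} w₀ dλ`; and the mass corollary `localTopFormHaar_univ_eq_of_definite_diagonal_of_mass`.

## References
* [Rogawski1990] J. D. Rogawski, *Automorphic Representations of Unitary Groups in Three Variables*, Ann. of Math. Stud. 123 (1990), §1.7 p. 6.
* [Macdonald1980] I. G. Macdonald, *The volume of a compact Lie group*, Invent. Math. 56 (1980), p. 93.
* [Knapp2002] A. W. Knapp, *Lie Groups Beyond an Introduction*, 2nd ed. (2002), I §1.
-/

set_option autoImplicit false
set_option backward.isDefEq.respectTransparency false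

noncomputable section

open Set Filter Topology MeasureTheory MeasureTheory.Measure Literature.Analysis.Calculus
open scoped Classical Matrix Matrix.Norms.Operator MatrixGroups ENNReal NNReal Pointwise

namespace Literature.NumberTheory.Weil1964

namespace UnitaryArchLocalTopForm

open Literature.NumberTheory.Automorphic Literature.NumberTheory.Automorphic.UnitaryGroup

/-! ## §1 `𝔲(r J) = 𝔲(J)`; the identity of carriers as an `Ad 1`-equivalence -/

section SameLieAlgebra

variable {N : ℕ} {Jw Jw₂ : Matrix (Fin N) (Fin N) ℂ}

/-- `𝔲(r J) = 𝔲(J)` for a real `r ≠ 0` (in particular `𝔲(−J) = 𝔲(J)`: the group `U(J)(ℂ)` does not see the sign of `J`). [cite: Knapp2002, I §1] -/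
theorem skewC_real_smul (r : ℝ) (hr : r ≠ 0) (Jw : Matrix (Fin N) (Fin N) ℂ) : skewC N ((r : ℂ) • Jw) = skewC N Jw := by
  ext X
  rw [mem_skewC_iff, mem_skewC_iff, Matrix.mul_smul, Matrix.smul_mul, ← smul_add, smul_eq_zero]
  exact ⟨fun h => h.resolve_left (Complex.ofReal_ne_zero.2 hr), fun h => Or.inr h⟩

/-- `𝔲(−J) = 𝔲(J)`. [cite: Knapp2002, I §1] -/
theorem skewC_neg (Jw : Matrix (Fin N) (Fin N) ℂ) : skewC N (-Jw) = skewC N Jw := by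
  have h := skewC_real_smul (N := N) (-1) (by norm_num) Jw
  rwa [Complex.ofReal_neg, Complex.ofReal_one, neg_one_smul] at h

/-- **The identity of carriers as an `Ad 1`-equivalence**: if `𝔲(J₂) = 𝔲(J)` then `X ↦ X` is a continuous linear isomorphism `e : 𝔲(J₂) ≃L[ℝ] 𝔲(J)` with `e X = 1·X·1⁻¹` — so every
transport lemma of ★ FILE 1 applies with `T = 1`. [cite: Knapp2002, I §1] -/
theorem exists_conjEquivC_one_of_skewC_eq (hS : skewC N Jw₂ = skewC N Jw) :
    ∃ e : skewC N Jw₂ ≃L[ℝ] skewC N Jw, ∀ X : skewC N Jw₂,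
      ((e X : skewC N Jw) : Matrix (Fin N) (Fin N) ℂ) = ((1 : GL (Fin N) ℂ) : Matrix (Fin N) (Fin N) ℂ) * (X : Matrix (Fin N) (Fin N) ℂ) * (((1 : GL (Fin N) ℂ)⁻¹ : GL (Fin N) ℂ) : Matrix (Fin N) (Fin N) ℂ) := by
  haveI : FiniteDimensional ℝ (Matrix (Fin N) (Fin N) ℂ) := finiteDimensional_matrixC
  refine ⟨(LinearEquiv.ofEq _ _ hS).toContinuousLinearEquiv, fun X => ?_⟩
  rw [inv_one, Units.val_one, Matrix.one_mul, Matrix.mul_one]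
  rfl

/-- Carriers with the same Lie algebra have the same window-free top-form integral. [cite: Macdonald1980, p. 93] [cite: Rogawski1990, §1.7 p. 6] -/
theorem setLIntegral_cayleyWeightC_cayleySourceC_eq_of_skewC_eq [MeasurableSpace (skewC N Jw)] [BorelSpace (skewC N Jw)]
    [MeasurableSpace (skewC N Jw₂)] [BorelSpace (skewC N Jw₂)] (hS : skewC N Jw₂ = skewC N Jw) :
    ∫⁻ X in cayleySourceC N Jw, ENNReal.ofReal (cayleyWeightC N Jw X) ∂(lieStdLebesgueC N Jw) =
      ∫⁻ X in cayleySourceC N Jw₂, ENNReal.ofReal (cayleyWeightC N Jw₂ X) ∂(lieStdLebesgueC N Jw₂) := by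
  obtain ⟨e, he⟩ := exists_conjEquivC_one_of_skewC_eq (Jw := Jw) (Jw₂ := Jw₂) hS
  exact setLIntegral_cayleyWeightC_cayleySourceC_eq_of_conj e he

end SameLieAlgebra

/-! ## §2 Same-sign real diagonal forms are congruent by a positive real diagonal matrix -/

section Diagonal

variable {n : ℕ}

/-- `diag(t)ᴴ · diag(d) · diag(t) = diag(d′)` for `t_i = √(d′_i ∕ d_i)` (real, `d_i d′_i > 0`). [cite: Knapp2002, I §1] -/
theorem formCongr_diagonal_real_sqrt (d d' : Fin n → ℝ) (h : ∀ i, 0 < d i * d' i)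
    (hdet : (Matrix.diagonal fun i => ((Real.sqrt (d' i / d i) : ℝ) : ℂ)).det ≠ 0) :
    formCongr (starRingEnd ℂ) (Matrix.GeneralLinearGroup.mkOfDetNeZero _ hdet) (Matrix.diagonal fun i => (d i : ℂ)) = Matrix.diagonal fun i => (d' i : ℂ) := by
  rw [formCongr]
  change ((Matrix.diagonal fun i => ((Real.sqrt (d' i / d i) : ℝ) : ℂ)).map (starRingEnd ℂ))ᵀ * (Matrix.diagonal fun i => (d i : ℂ)) *
      (Matrix.diagonal fun i => ((Real.sqrt (d' i / d i) : ℝ) : ℂ)) = Matrix.diagonal fun i => (d' i : ℂ)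
  rw [Matrix.diagonal_map (map_zero _), Matrix.diagonal_transpose, Matrix.diagonal_mul_diagonal, Matrix.diagonal_mul_diagonal]
  congr 1
  funext i
  have hdi : d i ≠ 0 := fun h0 => by have := h i; rw [h0, zero_mul] at this; exact lt_irrefl _ this
  have hq : 0 ≤ d' i / d i := by
    have : d' i / d i = (d i * d' i) / (d i * d i) := by field_simp
    rw [this]; exact div_nonneg (h i).le (mul_self_nonneg _)
  rw [Complex.conj_ofReal, mul_right_comm, ← Complex.ofReal_mul, Real.mul_self_sqrt hq, ← Complex.ofReal_mul, div_mul_cancel₀ _ hdi]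

/-- **Same-sign real diagonal forms are congruent**: `∃ T ∈ GL_n(ℂ)` (a positive real diagonal) with `Tᴴ diag(d) T = diag(d′)` whenever `d_i d′_i > 0` for all `i`. [cite: Knapp2002, I §1] -/
theorem exists_formCongr_diagonal_of_forall_mul_pos (d d' : Fin n → ℝ) (h : ∀ i, 0 < d i * d' i) :
    ∃ T : GL (Fin n) ℂ, formCongr (starRingEnd ℂ) T (Matrix.diagonal fun i => (d i : ℂ)) = Matrix.diagonal fun i => (d' i : ℂ) := by
  have hdet : (Matrix.diagonal fun i => ((Real.sqrt (d' i / d i) : ℝ) : ℂ)).det ≠ 0 := by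
    rw [Matrix.det_diagonal, Finset.prod_ne_zero_iff]
    intro i _
    have hdi : d i ≠ 0 := fun h0 => by have := h i; rw [h0, zero_mul] at this; exact lt_irrefl _ this
    have hq : 0 < d' i / d i := by
      have : d' i / d i = (d i * d' i) / (d i * d i) := by field_simp
      rw [this]; exact div_pos (h i) (mul_self_pos.2 hdi)
    exact Complex.ofReal_ne_zero.2 (Real.sqrt_pos.2 hq).ne'
  exact ⟨_, formCongr_diagonal_real_sqrt d d' h hdet⟩

end Diagonal

/-! ## §3 Definite real diagonal carriers of one size share the window-free top-form integral -/

section Definite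

variable {n : ℕ}

/-- Same-sign real diagonal carriers have the same window-free top-form integral (congruence, ★ FILE 1). [cite: Macdonald1980, p. 93] [cite: Rogawski1990, §1.7 p. 6] -/
theorem setLIntegral_cayleyWeightC_cayleySourceC_eq_of_forall_mul_pos (d d' : Fin n → ℝ) (h : ∀ i, 0 < d i * d' i)
    [MeasurableSpace (skewC n (Matrix.diagonal fun i => (d i : ℂ)))] [BorelSpace (skewC n (Matrix.diagonal fun i => (d i : ℂ)))]
    [MeasurableSpace (skewC n (Matrix.diagonal fun i => (d' i : ℂ)))] [BorelSpace (skewC n (Matrix.diagonal fun i => (d' i : ℂ)))] :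
    ∫⁻ X in cayleySourceC n (Matrix.diagonal fun i => (d i : ℂ)), ENNReal.ofReal (cayleyWeightC n _ X) ∂(lieStdLebesgueC n _) =
      ∫⁻ X in cayleySourceC n (Matrix.diagonal fun i => (d' i : ℂ)), ENNReal.ofReal (cayleyWeightC n _ X) ∂(lieStdLebesgueC n _) := by
  obtain ⟨T, hT⟩ := exists_formCongr_diagonal_of_forall_mul_pos d d' h
  obtain ⟨e, he⟩ := exists_conjEquivC hT
  exact setLIntegral_cayleyWeightC_cayleySourceC_eq_of_conj e he

/-- **DEFINITE REAL DIAGONAL CARRIERS OF ONE SIZE SHARE THE WINDOW-FREE TOP-FORM INTEGRAL**: if all `d_i` have one sign and all `d′_i` have one sign (possibly the other one), then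
`∫_{source(diag d)} w₀ dλ = ∫_{source(diag d′)} w₀ dλ` (same sign: congruence; opposite signs: `𝔲(−J) = 𝔲(J)` first).  This is the (cpt) «ONE `V` for all carriers and places»
of U4, at the level of the window-free integrals. [cite: Macdonald1980, p. 93] [cite: Rogawski1990, §1.7 p. 6] -/
theorem setLIntegral_cayleyWeightC_cayleySourceC_eq_of_definite_diagonal (d d' : Fin n → ℝ)
    (hd : (∀ i, 0 < d i) ∨ (∀ i, d i < 0)) (hd' : (∀ i, 0 < d' i) ∨ (∀ i, d' i < 0))
    [MeasurableSpace (skewC n (Matrix.diagonal fun i => (d i : ℂ)))] [BorelSpace (skewC n (Matrix.diagonal fun i => (d i : ℂ)))]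
    [MeasurableSpace (skewC n (Matrix.diagonal fun i => (d' i : ℂ)))] [BorelSpace (skewC n (Matrix.diagonal fun i => (d' i : ℂ)))] :
    ∫⁻ X in cayleySourceC n (Matrix.diagonal fun i => (d i : ℂ)), ENNReal.ofReal (cayleyWeightC n _ X) ∂(lieStdLebesgueC n _) =
      ∫⁻ X in cayleySourceC n (Matrix.diagonal fun i => (d' i : ℂ)), ENNReal.ofReal (cayleyWeightC n _ X) ∂(lieStdLebesgueC n _) := by
  -- either the signs agree entrywise, or they disagree entrywise
  by_cases hsame : ∀ i, 0 < d i * d' i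
  · exact setLIntegral_cayleyWeightC_cayleySourceC_eq_of_forall_mul_pos d d' hsame
  · -- opposite signs: compare `d` with `−d′` (same sign), then `𝔲(diag(−d′)) = 𝔲(diag d′)`
    have hopp : ∀ i, 0 < d i * (-d' i) := by
      intro i
      rcases hd with hp | hm <;> rcases hd' with hp' | hm'
      · exact absurd (fun j => mul_pos (hp j) (hp' j)) hsame
      · have := mul_pos (hp i) (neg_pos.2 (hm' i)); linarith
      · have := mul_pos (neg_pos.2 (hm i)) (hp' i); nlinarith
      · exact absurd (fun j => mul_pos_of_neg_of_neg (hm j) (hm' j)) hsame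
    have hS : skewC n (Matrix.diagonal fun i => ((-d' i : ℝ) : ℂ)) = skewC n (Matrix.diagonal fun i => (d' i : ℂ)) := by
      have : (Matrix.diagonal fun i => ((-d' i : ℝ) : ℂ)) = ((-1 : ℝ) : ℂ) • Matrix.diagonal fun i => (d' i : ℂ) := by
        ext i j
        rw [Matrix.smul_apply, Matrix.diagonal_apply, Matrix.diagonal_apply]
        split_ifs <;> push_cast <;> ring
      rw [this, skewC_real_smul (-1) (by norm_num)]
    letI : MeasurableSpace (skewC n (Matrix.diagonal fun i => ((-d' i : ℝ) : ℂ))) := borel _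
    haveI : BorelSpace (skewC n (Matrix.diagonal fun i => ((-d' i : ℝ) : ℂ))) := ⟨rfl⟩
    rw [setLIntegral_cayleyWeightC_cayleySourceC_eq_of_forall_mul_pos d (fun i => -d' i) hopp]
    exact (setLIntegral_cayleyWeightC_cayleySourceC_eq_of_skewC_eq (Jw := Matrix.diagonal fun i => (d' i : ℂ)) (Jw₂ := Matrix.diagonal fun i => ((-d' i : ℝ) : ℂ)) hS).symm

/-- **THE (cpt) MASS IS CARRIER-FREE, hypothesis form**: if the total mass of `localTopFormHaar` is the source integral of the weight (U4-discharge piece (ii)) for the two definite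
real diagonal carriers `diag d`, `diag d′` of one size, then `vol^TF(U(diag d)(ℂ)) = vol^TF(U(diag d′)(ℂ))`. [cite: Rogawski1990, §1.7 p. 6] [cite: Macdonald1980, p. 93] -/
theorem localTopFormHaar_univ_eq_of_definite_diagonal_of_mass [MeasurableSpace (GL (Fin n) ℂ)] [BorelSpace (GL (Fin n) ℂ)] (d d' : Fin n → ℝ)
    (hd : (∀ i, 0 < d i) ∨ (∀ i, d i < 0)) (hd' : (∀ i, 0 < d' i) ∨ (∀ i, d' i < 0))
    [MeasurableSpace (skewC n (Matrix.diagonal fun i => (d i : ℂ)))] [BorelSpace (skewC n (Matrix.diagonal fun i => (d i : ℂ)))]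
    [MeasurableSpace (skewC n (Matrix.diagonal fun i => (d' i : ℂ)))] [BorelSpace (skewC n (Matrix.diagonal fun i => (d' i : ℂ)))]
    (hmass : localTopFormHaar n (Matrix.diagonal fun i => (d i : ℂ)) Set.univ =
      ∫⁻ X in cayleySourceC n (Matrix.diagonal fun i => (d i : ℂ)), ENNReal.ofReal (cayleyWeightC n _ X) ∂(lieStdLebesgueC n _))
    (hmass' : localTopFormHaar n (Matrix.diagonal fun i => (d' i : ℂ)) Set.univ =
      ∫⁻ X in cayleySourceC n (Matrix.diagonal fun i => (d' i : ℂ)), ENNReal.ofReal (cayleyWeightC n _ X) ∂(lieStdLebesgueC n _)) :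
    localTopFormHaar n (Matrix.diagonal fun i => (d i : ℂ)) Set.univ = localTopFormHaar n (Matrix.diagonal fun i => (d' i : ℂ)) Set.univ := by
  rw [hmass, hmass', setLIntegral_cayleyWeightC_cayleySourceC_eq_of_definite_diagonal d d' hd hd']

end Definite

end UnitaryArchLocalTopForm

end Literature.NumberTheory.Weil1964

end
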